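import Mathlib
import Summits.Ventures.PercRepro.TriangleCapRowBCorner

/-!
# PercRepro — THE NON-BIPARTITE STABILITY TABLE AND THE SECOND-BEST VALUE OF THE CHERRY TABLE ON EVERY CELL
`(k, a, r)` WITH `r ≤ a − 1`, `5 ≤ a ≤ 18`, `2a + r ≤ k` (`2a + 2 ≤ k`), IN ONE STATEMENT EACH (p3, gen 47; part 200j)

`stabGap k a r = 2 (k − 2a − 1)(a − r)` (the family `B2`) for `r ≤ a − 3` and `2 (k − 2a − 1)` (the one-triangle family
`T` at `r = a − 2`, the family `B2` at `r = a − 1`) otherwise — the value `min {B2, T}` of §10bt(e). `stab_table`: every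
non-`a`-bipartite `K₄⁻`-free graph on `Fin k` with `a (k − a) − r` edges has
`Σ_v d(v)² + r (k − 1 − r) + stabGap k a r ≤ m k`, and the value is attained by a non-`a`-bipartite graph
(parts 200e, 200i, 200l). `cherry_second_best_table`: for `3 ≤ r ≤ a − 1` the second-best value of `Σ_v d(v)²` over
the non-extremal `K₄⁻`-free graphs on the cell is EXACTLY `m k − r (k − 1 − r) − 2 (r − 2)` (the brooms).
Axioms: standard.
-/

namespace PercRepro

namespace TriangleCap

namespace C047

open Finset

/-- The non-bipartite gap of the stability table on the cells `r ≤ a − 1`: `B2 = 2 (k − 2a − 1)(a − r)` where the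
family `T` does not exist (`r ≤ a − 3`), `2 (k − 2a − 1)` at `r = a − 2` (`T`) and `r = a − 1` (`B2`). -/
def stabGap (k a r : ℕ) : ℕ :=
  if r + 3 ≤ a then 2 * (k - 2 * a - 1) * (a - r) else 2 * (k - 2 * a - 1)

/-- **THE NON-BIPARTITE STABILITY TABLE ON EVERY CELL `r ≤ a − 1` OF EVERY ROW `5 ≤ a ≤ 18`, `2a + r ≤ k`,
`2a + 2 ≤ k`:** every non-`a`-bipartite `K₄⁻`-free graph on `Fin k` with `a (k − a) − r` edges has
`Σ_v d(v)² + r (k − 1 − r) + stabGap k a r ≤ m k`, and the value is attained by a non-`a`-bipartite graph. -/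
theorem stab_table (k a r : ℕ) (ha5 : 5 ≤ a) (ha18 : a ≤ 18) (hr : r + 1 ≤ a) (hk : 2 * a + r ≤ k)
    (hk2 : 2 * a + 2 ≤ k) :
    (∀ (D : SimpleGraph (Fin k)) [DecidableRel D.Adj], K4mFree D → D.edgeFinset.card + r = a * (k - a) →
        (¬ ∃ A : Finset (Fin k), A.card = a ∧ BipSub D A) →
        ∑ v, deg D v * deg D v + r * (k - 1 - r) + stabGap k a r ≤ D.edgeFinset.card * k) ∧
      ∃ (D : SimpleGraph (Fin k)) (_ : DecidableRel D.Adj), K4mFree D ∧ D.edgeFinset.card + r = a * (k - a) ∧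
        (¬ ∃ A : Finset (Fin k), A.card = a ∧ BipSub D A) ∧
        ∑ v, deg D v * deg D v + r * (k - 1 - r) + stabGap k a r = D.edgeFinset.card * k := by
  by_cases h3 : r + 3 ≤ a
  · have hgap : stabGap k a r = 2 * (k - 2 * a - 1) * (a - r) := by simp [stabGap, h3]
    rw [hgap]
    exact below_nonbip_second_best_all k a r (by omega) ha18 h3 hk2 hk
  · have hgap : stabGap k a r = 2 * (k - 2 * a - 1) := by simp [stabGap, h3]
    rw [hgap]
    rcases Nat.lt_or_ge (r + 1) a with hr2 | hr1
    · have hr' : r = a - 2 := by omega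
      subst hr'
      exact rowT_nonbip_second_best k a ha5 ha18 (by omega)
    · have hr' : r = a - 1 := by omega
      subst hr'
      exact rowB_nonbip_second_best_all k a ha5 ha18 (by omega)

/-- **THE SECOND-BEST VALUE OF THE CHERRY TABLE ON EVERY CELL `3 ≤ r ≤ a − 1` OF EVERY ROW `5 ≤ a ≤ 18`,
`2a + r ≤ k`:** every non-extremal `K₄⁻`-free graph on `Fin k` with `a (k − a) − r` edges has
`Σ_v d(v)² + r (k − 1 − r) + 2 (r − 2) ≤ m k`, and the value is attained (the brooms). -/
theorem cherry_second_best_table (k a r : ℕ) (ha5 : 5 ≤ a) (ha18 : a ≤ 18) (hr3 : 3 ≤ r) (hr : r + 1 ≤ a)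
    (hk : 2 * a + r ≤ k) :
    (∀ (D : SimpleGraph (Fin k)) [DecidableRel D.Adj], K4mFree D → D.edgeFinset.card + r = a * (k - a) →
        ∑ v, deg D v * deg D v + r * (k - 1 - r) ≠ D.edgeFinset.card * k →
        ∑ v, deg D v * deg D v + r * (k - 1 - r) + 2 * (r - 2) ≤ D.edgeFinset.card * k) ∧
      ∃ (D : SimpleGraph (Fin k)) (_ : DecidableRel D.Adj), K4mFree D ∧ D.edgeFinset.card + r = a * (k - a) ∧
        ∑ v, deg D v * deg D v + r * (k - 1 - r) + 2 * (r - 2) = D.edgeFinset.card * k := by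
  by_cases h3 : r + 3 ≤ a
  · exact second_best_below_all k a r (by omega) ha18 hr3 h3 hk
  have hcard : Fintype.card (Fin k) = k := Fintype.card_fin k
  refine ⟨?_, ?_⟩
  · intro D _ hK hm hne
    have hmain : (∃ A : Finset (Fin k), A.card = a ∧ BipSub D A) ∨
        ∑ v, deg D v * deg D v + r * (k - 1 - r) + 2 * (k - 2 * a - 1) ≤ D.edgeFinset.card * k := by
      rcases Nat.lt_or_ge (r + 1) a with hr2 | hr1
      · have := rowT_second_order_gen D hK a r ha5 ha18 (by omega) (by rw [hcard]; omega) (by rw [hcard]; exact hm)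
        rw [hcard] at this
        exact this
      · have := rowB_second_order_all D hK a r ha5 ha18 (by omega) (by rw [hcard]; omega) (by rw [hcard]; exact hm)
        rw [hcard] at this
        exact this
    rcases hmain with ⟨A, hAcard, hB⟩ | h
    · by_cases hstar : ∃ v, MissingStar D A v
      · obtain ⟨v, hv⟩ := hstar
        have h := closed_form_eq_of_missingStar D A hB hv a r hAcard (by rw [hcard]; exact hm) (by rw [hcard]; omega)
        rw [hcard] at h
        exact absurd h hne
      · have h := closed_form_stability_bipSub D A hB a r hAcard (by rw [hcard]; exact hm) (by rw [hcard]; omega)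
          (by omega) hstar
        rw [hcard] at h
        exact h
    · omega
  · obtain ⟨D, inst, A, hK, hAcard, hB, hns, hE, hS⟩ := broom_value k a r (by omega) hr3 (by omega)
    have hr' : r ≤ a * (k - a) := by
      have h1 : a + r ≤ k - a := by omega
      have h2 : a * (a + r) ≤ a * (k - a) := Nat.mul_le_mul_left a h1
      nlinarith [h2]
    have hE' : D.edgeFinset.card + r = a * (k - a) := by rw [hE]; omega
    refine ⟨D, inst, hK, hE', ?_⟩
    rw [hE]
    exact hS

end C047

end TriangleCap

end PercRepro
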